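import Literature.IUT.HodgeArakelov.PlusMinusTowerCoverModel
import Literature.IUT.HodgeArakelov.StableCurveAgreementClosedTower
import HarnessLib

/-!
# [IUTchII] Def 2.3 (i)(ii) / B13-GENUINE: the agreement `StableCurveAgreement` AT THE GENUINE `±`-tower `PlusMinusTower.ofCoverModel`

S. Mochizuki, *Inter-universal Teichmüller Theory II*, kurims manuscript (Dec. 2020), §2, Def 2.3 (i)(ii) pp. 67–68
(«`Π^±_v := Π^tp_{X_v}`, `Π̂^±_v := Π̂_{X_v}`»; «the cuspidal inertia groups of `Π_⊆` may be obtained as the intersections with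
`Π_⊆` of those cuspidal inertia groups of `Π_⊇` …»); *Inter-universal Teichmüller Theory I* (May 2020), §2 p. 46 (cusps `x`,
`I_x ⊆ Δ^tp_X`); [SemiAnbd] §6 p. 71 («`I_x := D_x ∩ Δ^temp_X`») [cite: Mochizuki2012, II Def 2.3 (i)(ii) pp.67–68; I §2 p.46]
[cite: MochizukiSemiAnbd2006, §6 p.71].  abc-iut cell, MERGE-MAP rows B13/B14 (plan/L6/MERGE-MAP.md v29), lineage row «B13-GENUINE»,
seat abc-iut-w5-d132 (gen 4).  PROOF-ONLY (no `def`, no `instance`, no `structure`); consumes abc-iut-L6-t19's B14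
`PlusMinusTower.ofCoverModel` (the GENUINE tower at `v ∈ 𝕍^bad` built from the [EtTh] tempered data inside a profinite completion
`ι : Π^tp_C → Q` with augmentation `Φ`) and this seat's `StableCurveAgreement.exists_agreement_of_geometric_family` (p427830) BY NAME.

* the topological side conditions at the genuine tower: `Q` compact (`hι.compactSpace`), `G_K` Hausdorff (private), `ofCoverModel_isClosed_pmHat` (`Π̂^±_v` = a closure), `ofCoverModel_continuous_aug` (for continuous `Φ` — e.g.
  the extension of p424688 `exists_augHat`); `ofCoverModel_aug_ι` / `ofCoverModel_aug_ι_inclX` (`aug ∘ ι = augC`,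
  `aug ∘ ι ∘ inclX = aug_X`), `map_ι_conj_le_ker_aug`, `map_ι_le_piPM`;
* **`exists_stableCurveAgreement_ofCoverModel`** — the CUSP FAMILY of `Π^±_v = Π^tp_{X̲_v}`,
  `I (x, g) := ι((g · inclX(I_x) · g⁻¹) ∩ inclX(Π^tp_{X̲_v}))` (`x` a cusp of the model curve `X`, `I_x = D_x ∩ Δ^tp_X`, `g ∈ Π^tp_C`), is
  geometric and lies in `Π^±_v`, hence generates a cuspidal-inertia datum `Cu` on the genuine tower — characterised at every level by
  «`J ⊆ Π_□` and `J` is a `Π^±_v`-conjugate of some `I (x, g)`», and STABLE UNDER `Π^cor_v`-CONJUGATION at the level `Π^±_v`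
  ([IUTchII] Rmk 2.3.1; the tempered shadow of GAP-LEDGER G-w5d243-1's law (a); `conj_ι_smul_cuspFamily`) — WITH an [IUTchI] §2
  datum `D` and an agreement `StableCurveAgreement (ofCoverModel …) Cu D`.

* `exists_stableCurveAgreement_ofPiCHat` — the same at B14's tower of record `ofPiCHat` (inside abc-iut-L2-d3's `Π_C`, augmentation
  `piCData.aug`), with no continuity binder.

HONEST LABEL: GENUINE RELATIVE TO (tower, cusp family) — the tower and the cusps are the genuine [EtTh]/[SemiAnbd] §6 objects; the
[IUTchI] §2 datum `D` is the record built from the tower by p421263 (special fibre `= Δ` with one component, `eHat = id`), NOT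
abc-iut-L5's stable-curve datum of the special fibre (whose identification with the tower is the separate «common model» task,
[IUTchI] Def 3.1 (e)); and the generated cuspidal datum lives at the tempered level `Π^±_v` (the profinite-level cuspidal inertia groups
of print — closures and their `Π̂`-conjugates — are not modelled; the agreement reads `Π^±_v` only).  Binders: those of `ofCoverModel`
(L02 `hZ`, arithmetic normality `hN`, the parameters `ι`, `Φ`) + `Continuous Φ`.
Nothing of the series is asserted; consistency ≠ endorsement; no side taken on [IUTchIII] Cor 3.12.
-/

noncomputable section

namespace Literature.IUT.HodgeArakelov

open Literature.AnabelianGeometry.EtaleTheta Literature.AnabelianGeometry.SemiGraphs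
open scoped Pointwise

namespace PlusMinusTower

variable {p : ℕ} [Fact p.Prime] {M : MuTwoSetting p} (e : M.CLevelData)
  {E : M.toThetaSetting.EtaleThetaData} {l : ℕ} (C : E.DoubleUnderline l) {N : ℕ+}
  (μ : M.toThetaSetting.CyclotomeMod l N) (hC : M.toThetaSetting.Compat) (hS : M.toThetaSetting.Sec2Hyps)
  (hl : l.Prime) (hp2 : p ≠ 2) (hpl : p ≠ l) (hζ : ∃ ζ : M.toThetaSetting.K, IsPrimitiveRoot ζ (4 * l))
  {η : (C.thetaEnvData μ hC hS).PiYdd → MuN p N} (hη : η ∈ (C.thetaEnvData μ hC hS).thetaCocycles)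
  {Q : Type} [Group Q] [TopologicalSpace Q] [IsTopologicalGroup Q]
  (ι : M.GtpC →ₜ* Q) (hι : IsProfiniteCompletion ι) (hinj : Function.Injective ι)
  (Φ : Q →* GQp p) (hΦ : ∀ g : M.GtpC, Φ (ι g) = e.augC g) (hΦK : Φ.range = M.GK)
  (hZ : Thm16Sub.KerToZIsCompactlyGenerated M.toThetaSetting) (hN : (C.Huu.subgroupOf (M.GtpXu l)).Normal)
  {P : TopGroup.{0}} (T : TemperedCoverings (BadPlaceSetting.ofUnderline C μ hC hS hl hp2 hpl hζ hη) P)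

/-! ### The topological side conditions at the genuine tower -/

/-- `G_v = G_K ≤ G_{ℚ_p}` (Krull topology) is Hausdorff. [folklore] -/
private theorem ofCoverModel_t2Space_gk : T2Space (BadPlaceSetting.ofUnderline C μ hC hS hl hp2 hpl hζ hη).Gk :=
  inferInstanceAs (T2Space ↥M.GK)

/-- `Π̂^±_v = cl ι(inclX Π^tp_{X̲_v})` is closed in `Π̂^cor_v`. ([IUTchII] Def 2.3 (i), kurims p.67) [claim: Mochizuki2012, status: disputed] -/
theorem ofCoverModel_isClosed_pmHat :
    IsClosed ((ofCoverModel e C μ hC hS hl hp2 hpl hζ hη ι hι hinj Φ hΦ hΦK hZ hN T).pmHat :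
      Set (ofCoverModel e C μ hC hS hl hp2 hpl hζ hη ι hι hinj Φ hΦ hΦK hZ hN T).Corhat) := by
  change IsClosed (((((M.GtpXu l).map M.inclX).map ι.toMonoidHom).topologicalClosure : Subgroup Q) : Set Q)
  exact Subgroup.isClosed_topologicalClosure _

/-- The augmentation `Π̂^cor_v → G_v` of the tower is continuous as soon as `Φ` is (e.g. `Φ` = the continuous extension of
`augC`, p424688 `exists_augHat`). ([IUTchII] Def 2.3 (i), kurims p.67) [claim: Mochizuki2012, status: disputed] -/
theorem ofCoverModel_continuous_aug (hΦc : Continuous Φ) :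
    Continuous (ofCoverModel e C μ hC hS hl hp2 hpl hζ hη ι hι hinj Φ hΦ hΦK hZ hN T).aug := by
  change Continuous (coverModelAug C μ hC hS hl hp2 hpl hζ hη Φ hΦK)
  exact hΦc.subtype_mk _

include hΦ in
/-- `aug ∘ ι = augC` on `Π^tp_C`: the tower's augmentation restricted along `ι` is the augmentation of `C` (`Φ ∘ ι = augC`).
[cite: MochizukiEtTh2009, Def 2.1 p.36] -/
theorem ofCoverModel_aug_ι (z : M.GtpC) :
    ((ofCoverModel e C μ hC hS hl hp2 hpl hζ hη ι hι hinj Φ hΦ hΦK hZ hN T).aug (ι z)).1 = e.augC z := by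
  change Φ (ι z) = _
  rw [hΦ]

include hΦ in
/-- `aug ∘ ι ∘ inclX = aug_X` on `Π^tp_X` (`Φ ∘ ι = augC`, `augC ∘ inclX = aug`). [cite: MochizukiEtTh2009, Def 2.1 p.36] -/
theorem ofCoverModel_aug_ι_inclX (y : M.PiTemp) :
    ((ofCoverModel e C μ hC hS hl hp2 hpl hζ hη ι hι hinj Φ hΦ hΦK hZ hN T).aug (ι (M.inclX y))).1 = M.aug y := by
  rw [ofCoverModel_aug_ι e C μ hC hS hl hp2 hpl hζ hη ι hι hinj Φ hΦ hΦK hZ hN T, e.augC_inclX]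

include hΦ in
/-- Hence `ι` carries every `Π^tp_C`-conjugate of (the image of) a subgroup of `Δ^tp_X` into `Δ̂^cor_v = Ker(aug)` (`Ker(augC)` is normal
in `Π^tp_C` and contains `inclX(Δ^tp_X)`). [cite: MochizukiEtTh2009, Def 2.1 p.36] -/
theorem map_ι_conj_le_ker_aug (H : Subgroup M.PiTemp) (hH : H ≤ M.toTemperedCurve.DeltaTemp) (g : M.GtpC)
    (H' : Subgroup M.GtpC) (hH' : H' ≤ MulAut.conj g • H.map M.inclX) :
    H'.map ι.toMonoidHom ≤ (ofCoverModel e C μ hC hS hl hp2 hpl hζ hη ι hι hinj Φ hΦ hΦK hZ hN T).aug.ker := by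
  rintro _ ⟨z, hz, rfl⟩
  have hz' := hH' hz
  rw [Subgroup.mem_smul_pointwise_iff_exists] at hz'
  obtain ⟨_, ⟨y, hy, rfl⟩, rfl⟩ := hz'
  show (ofCoverModel e C μ hC hS hl hp2 hpl hζ hη ι hι hinj Φ hΦ hΦK hZ hN T).aug (ι (MulAut.conj g • M.inclX y)) = 1
  apply Subtype.ext
  change ((ofCoverModel e C μ hC hS hl hp2 hpl hζ hη ι hι hinj Φ hΦ hΦK hZ hN T).aug (ι (MulAut.conj g • M.inclX y))).1 = 1
  rw [ofCoverModel_aug_ι e C μ hC hS hl hp2 hpl hζ hη ι hι hinj Φ hΦ hΦK hZ hN T, MulAut.smul_def, MulAut.conj_apply,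
    map_mul, map_mul, map_inv, e.augC_inclX y]
  have hy1 : M.aug y = 1 := hH hy
  rw [hy1, mul_one, mul_inv_cancel]

/-- `ι` carries subgroups of `inclX(Π^tp_{X̲_v})` into `Π^±_v = emb(Π^tp_{X_v}(P))` (through the chosen `plainIso`).
([IUTchII] Def 2.3 (i), kurims p.67) [claim: Mochizuki2012, status: disputed] -/
theorem map_ι_le_piPM (H' : Subgroup M.GtpC) (hH' : H' ≤ (M.GtpXu l).map M.inclX) :
    H'.map ι.toMonoidHom ≤ (ofCoverModel e C μ hC hS hl hp2 hpl hζ hη ι hι hinj Φ hΦ hΦK hZ hN T).piPM := by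
  rintro _ ⟨z, hz, rfl⟩
  obtain ⟨y, hy, rfl⟩ := hH' hz
  refine ⟨T.plainIso.symm ⟨y, hy⟩, ?_⟩
  change coverModelEmb C μ hC hS hl hp2 hpl hζ hη ι T (T.plainIso.symm ⟨y, hy⟩) = ι (M.inclX y)
  rw [coverModelEmb_apply, ContinuousMulEquiv.apply_symm_apply]

omit [TopologicalSpace Q] [IsTopologicalGroup Q] in
/-- Transport of conjugation through `ι`: `ι(k) · ι(K) · ι(k)⁻¹ = ι(k K k⁻¹)`. [folklore] -/
private theorem conj_ι_smul_map {Q : Type} [Group Q] (ι : M.GtpC →* Q) (k : M.GtpC) (K : Subgroup M.GtpC) :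
    MulAut.conj (ι k) • K.map ι = (MulAut.conj k • K).map ι := by
  rw [Subgroup.pointwise_smul_def, Subgroup.pointwise_smul_def, Subgroup.map_map, Subgroup.map_map]
  congr 1
  ext x
  simp

include e hZ in
omit [TopologicalSpace Q] [IsTopologicalGroup Q] in
/-- **The cusp family is permuted by `Π^cor_v`-conjugation** ([IUTchII] Rmk 2.3.1, kurims p.69: the cuspidal inertia groups of the
normal subgroup are permuted by conjugation): for `g, g₀ ∈ Π^tp_C` and `h ∈ inclX(Π^tp_{X̲_v})`,
`ι(g h) · ι((g₀ I g₀⁻¹) ∩ inclX(Π^tp_{X̲_v})) · ι(g h)⁻¹ = ι(((g h g₀) I (g h g₀)⁻¹) ∩ inclX(Π^tp_{X̲_v}))` — because `inclX(Π^tp_{X̲_v}) ⊴ Π^tp_C`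
(abc-iut-L6-t19 `map_inclX_GtpXu_normal`, mod L02). [claim: Mochizuki2012, status: disputed] (IUTchII §2 Rmk 2.3.1, kurims p.69) -/
theorem conj_ι_smul_cuspFamily {Q : Type} [Group Q] (ι : M.GtpC →* Q) (g h g₀ : M.GtpC) (Ix : Subgroup M.GtpC) :
    MulAut.conj (ι (g * h)) • (((MulAut.conj g₀ • Ix) ⊓ (M.GtpXu l).map M.inclX).map ι) =
      ((MulAut.conj (g * h * g₀) • Ix) ⊓ (M.GtpXu l).map M.inclX).map ι := by
  haveI := e.map_inclX_GtpXu_normal l hZ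
  rw [conj_ι_smul_map, Subgroup.smul_inf, ← mul_smul, ← map_mul,
    Subgroup.Normal.conj_smul_eq_self (g * h) ((M.GtpXu l).map M.inclX)]

/-! ### B13-GENUINE: the cusp family of `X̲_v` and the agreement at the genuine tower -/

include hΦ in
/-- **[IUTchII] Def 2.3 (i)(ii) — B13 AT THE GENUINE `±`-TOWER `ofCoverModel`.**  The CUSP FAMILY of `Π^±_v = Π^tp_{X̲_v}`:
`I (x, g) := ι((g · inclX(I_x) · g⁻¹) ∩ inclX(Π^tp_{X̲_v}))` for `x` a CUSP of the model curve `X` with inertia group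
`I_x = D_x ∩ Δ^tp_X` ([SemiAnbd] §6 p.71) and `g ∈ Π^tp_C = Π^cor_v` (the cuspidal inertia groups of the normal open subgroup
`Π^tp_{X̲_v} ⊆ Π^tp_C` are the intersections with `Π^tp_{X̲_v}` of the conjugates of the `I_x` — Def 2.3 (ii) «intersections with
`Π_⊆`»; indexing by ALL of `Π^cor_v` (MERGE-MAP v31 RR6) makes the family stable under `Π^cor_v`-conjugation, cf. Rmk 2.3.1).  It is
GEOMETRIC (`⊆ Ker(aug)`: `I_x ⊆ Δ^tp_X` and `Ker(augC) ⊴ Π^tp_C`) and lies in `Π^±_v`, so by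
`StableCurveAgreement.exists_agreement_of_geometric_family` (p427830; `Π̂^cor_v` compact, `Π̂^±_v` closed, `aug` continuous for
continuous `Φ`, `G_v` Hausdorff) it generates a cuspidal-inertia datum `Cu` on the tower — characterised at every level `Π_□` by
«`J ⊆ Π_□` and `J` is a `Π^±_v`-conjugate of some `I (x, g)`», every `I (x, g)` cuspidal, the `Π^±_v`-cuspidal groups STABLE under
`Π^cor_v = ι(Π^tp_C)`-conjugation (Rmk 2.3.1 p.69; tempered shadow of GAP-LEDGER G-w5d243-1's law (a)) — together with an [IUTchI] §2
datum `D` and an AGREEMENT `StableCurveAgreement (ofCoverModel …) Cu D`.  PROVED.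
* `exists_stableCurveAgreement_ofPiCHat` — the same at B14's tower of record `ofPiCHat` (inside abc-iut-L2-d3's `Π_C`, augmentation
  `piCData.aug`), with no continuity binder.

HONEST LABEL: GENUINE RELATIVE TO (tower, cusp family).  (1) `D` is the record built from the tower by p421263 (special fibre `= Δ`
with one component, `eHat = id`), NOT abc-iut-L5's stable-curve datum of the special fibre of `X̲_v` (that identification is the
separate «common model» row, MERGE-MAP B15).  (2) `Cu` is the datum GENERATED AT THE TEMPERED LEVEL `Π^±_v`: at the other levels of
the tower (`Π_v`, `Π̂_v`, `Π̂^±_v`) it lists the same tempered groups by containment — print's PROFINITE-level cuspidal inertia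
groups (the `Π̂`-conjugates of the closures, Def 2.3 (ii)'s commensurator recipe) are NOT modelled by it; the agreement reads the
level `Π^±_v` only.  ([IUTchII] Def 2.3 (i)(ii), kurims pp.67–68) [claim: Mochizuki2012, status: disputed] -/
theorem exists_stableCurveAgreement_ofCoverModel (hΦc : Continuous Φ) :
    ∃ Cu : CuspidalInertiaData (ofCoverModel e C μ hC hS hl hp2 hpl hζ hη ι hι hinj Φ hΦ hΦK hZ hN T),
      (∀ Q' J : Subgroup (ofCoverModel e C μ hC hS hl hp2 hpl hζ hη ι hι hinj Φ hΦ hΦK hZ hN T).Corhat,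
        Cu.IsCuspidalInertia Q' J ↔ J ≤ Q' ∧ ∃ i : {x : M.Pt // M.IsCusp x} × M.GtpC,
          ∃ t ∈ (ofCoverModel e C μ hC hS hl hp2 hpl hζ hη ι hι hinj Φ hΦ hΦK hZ hN T).piPM,
            J = MulAut.conj t •
              (((MulAut.conj i.2 • (M.toTemperedCurve.inertia i.1.1).map M.inclX) ⊓ (M.GtpXu l).map M.inclX).map
              ι.toMonoidHom :
                Subgroup (ofCoverModel e C μ hC hS hl hp2 hpl hζ hη ι hι hinj Φ hΦ hΦK hZ hN T).Corhat)) ∧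
      (∀ i : {x : M.Pt // M.IsCusp x} × M.GtpC,
        Cu.IsCuspidalInertia (ofCoverModel e C μ hC hS hl hp2 hpl hζ hη ι hι hinj Φ hΦ hΦK hZ hN T).piPM
          (((MulAut.conj i.2 • (M.toTemperedCurve.inertia i.1.1).map M.inclX) ⊓ (M.GtpXu l).map M.inclX).map
              ι.toMonoidHom :
            Subgroup (ofCoverModel e C μ hC hS hl hp2 hpl hζ hη ι hι hinj Φ hΦ hΦK hZ hN T).Corhat)) ∧
      (∀ g' ∈ (ofCoverModel e C μ hC hS hl hp2 hpl hζ hη ι hι hinj Φ hΦ hΦK hZ hN T).cor, ∀ J : Subgroup (ofCoverModel e C μ hC hS hl hp2 hpl hζ hη ι hι hinj Φ hΦ hΦK hZ hN T).Corhat,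
        Cu.IsCuspidalInertia (ofCoverModel e C μ hC hS hl hp2 hpl hζ hη ι hι hinj Φ hΦ hΦK hZ hN T).piPM J → Cu.IsCuspidalInertia (ofCoverModel e C μ hC hS hl hp2 hpl hζ hη ι hι hinj Φ hΦ hΦK hZ hN T).piPM (MulAut.conj g' • J)) ∧
      ∃ D : Literature.IUT.HodgeTheaters.StableCurveTemperedData.{0},
        Nonempty (StableCurveAgreement (ofCoverModel e C μ hC hS hl hp2 hpl hζ hη ι hι hinj Φ hΦ hΦK hZ hN T) Cu D) := by
  haveI : CompactSpace (ofCoverModel e C μ hC hS hl hp2 hpl hζ hη ι hι hinj Φ hΦ hΦK hZ hN T).Corhat :=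
    hι.compactSpace
  haveI := ofCoverModel_t2Space_gk C μ hC hS hl hp2 hpl hζ hη
  obtain ⟨Cu, hchar, hI, hD⟩ := StableCurveAgreement.exists_agreement_of_geometric_family (ofCoverModel e C μ hC hS hl hp2 hpl hζ hη ι hι hinj Φ hΦ hΦK hZ hN T)
    (ofCoverModel_isClosed_pmHat e C μ hC hS hl hp2 hpl hζ hη ι hι hinj Φ hΦ hΦK hZ hN T)
    (ofCoverModel_continuous_aug e C μ hC hS hl hp2 hpl hζ hη ι hι hinj Φ hΦ hΦK hZ hN T hΦc)
    (fun i : {x : M.Pt // M.IsCusp x} × M.GtpC =>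
      ((((MulAut.conj i.2 • (M.toTemperedCurve.inertia i.1.1).map M.inclX) ⊓ (M.GtpXu l).map M.inclX).map
        ι.toMonoidHom : Subgroup (ofCoverModel e C μ hC hS hl hp2 hpl hζ hη ι hι hinj Φ hΦ hΦK hZ hN T).Corhat)))
    (fun i => map_ι_le_piPM e C μ hC hS hl hp2 hpl hζ hη ι hι hinj Φ hΦ hΦK hZ hN T _ inf_le_right)
    (fun i => map_ι_conj_le_ker_aug e C μ hC hS hl hp2 hpl hζ hη ι hι hinj Φ hΦ hΦK hZ hN T
      (M.toTemperedCurve.inertia i.1.1) inf_le_right i.2 _ inf_le_left)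
  refine ⟨Cu, hchar, hI, ?_, hD⟩
  -- `Π^cor_v`-conjugation permutes the cusp family (Rmk 2.3.1): `ι(g) · (t · I(x,g₀) · t⁻¹) · ι(g)⁻¹ = I(x, g·h·g₀)` for `t = ι(h)`
  rintro _ ⟨g, rfl⟩ J hJ
  rw [hchar] at hJ
  obtain ⟨-, ⟨x, g₀⟩, t, ht, rfl⟩ := hJ
  obtain ⟨x', rfl⟩ := ht
  have key : @MulAut.conj (ofCoverModel e C μ hC hS hl hp2 hpl hζ hη ι hι hinj Φ hΦ hΦK hZ hN T).Corhat _ (ι.toMonoidHom g) •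
      (MulAut.conj ((ofCoverModel e C μ hC hS hl hp2 hpl hζ hη ι hι hinj Φ hΦ hΦK hZ hN T).emb x') •
        ((((MulAut.conj g₀ • (M.toTemperedCurve.inertia x.1).map M.inclX) ⊓ (M.GtpXu l).map M.inclX).map
          ι.toMonoidHom : Subgroup (ofCoverModel e C μ hC hS hl hp2 hpl hζ hη ι hι hinj Φ hΦ hΦK hZ hN T).Corhat))) =
      (((MulAut.conj (g * M.inclX (T.plainIso x').1 * g₀) • (M.toTemperedCurve.inertia x.1).map M.inclX) ⊓
        (M.GtpXu l).map M.inclX).map ι.toMonoidHom : Subgroup (ofCoverModel e C μ hC hS hl hp2 hpl hζ hη ι hι hinj Φ hΦ hΦK hZ hN T).Corhat) := by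
    -- compute inside `Q` (the carrier of `Π̂^cor_v`), where the pointwise lemmas apply verbatim
    change MulAut.conj (ι.toMonoidHom g) • (MulAut.conj (ι.toMonoidHom (M.inclX (T.plainIso x').1)) •
        ((((MulAut.conj g₀ • (M.toTemperedCurve.inertia x.1).map M.inclX) ⊓ (M.GtpXu l).map M.inclX).map
          ι.toMonoidHom : Subgroup Q))) =
      (((MulAut.conj (g * M.inclX (T.plainIso x').1 * g₀) • (M.toTemperedCurve.inertia x.1).map M.inclX) ⊓
        (M.GtpXu l).map M.inclX).map ι.toMonoidHom : Subgroup Q)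
    rw [← mul_smul, ← map_mul, ← map_mul]
    exact conj_ι_smul_cuspFamily e hZ ι.toMonoidHom g (M.inclX (T.plainIso x').1) g₀ _
  rw [key]
  exact hI ⟨x, g * M.inclX (T.plainIso x').1 * g₀⟩


/-! ### The canonical instance inside abc-iut-L2-d3's `Π_C` -/

/-- **B13-GENUINE AT THE TOWER OF RECORD `ofPiCHat`** (B14's canonical instance inside abc-iut-L2-d3's `Π_C := e.PiCHat` with the
continuous augmentation `e.piCData.aug`): the statement of `exists_stableCurveAgreement_ofCoverModel` with NO continuity binder
(`piCData.aug` is continuous).  ([IUTchII] Def 2.3 (i)(ii), kurims pp.67–68) [claim: Mochizuki2012, status: disputed] -/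
theorem exists_stableCurveAgreement_ofPiCHat :
    ∃ Cu : CuspidalInertiaData (ofPiCHat e C μ hC hS hl hp2 hpl hζ hη hZ hN T),
      (∀ Q' J : Subgroup (ofPiCHat e C μ hC hS hl hp2 hpl hζ hη hZ hN T).Corhat,
        Cu.IsCuspidalInertia Q' J ↔ J ≤ Q' ∧ ∃ i : {x : M.Pt // M.IsCusp x} × M.GtpC,
          ∃ t ∈ (ofPiCHat e C μ hC hS hl hp2 hpl hζ hη hZ hN T).piPM,
            J = MulAut.conj t •
              (((MulAut.conj i.2 • (M.toTemperedCurve.inertia i.1.1).map M.inclX) ⊓ (M.GtpXu l).map M.inclX).map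
                e.toPiCHat.toMonoidHom : Subgroup (ofPiCHat e C μ hC hS hl hp2 hpl hζ hη hZ hN T).Corhat)) ∧
      (∀ i : {x : M.Pt // M.IsCusp x} × M.GtpC,
        Cu.IsCuspidalInertia (ofPiCHat e C μ hC hS hl hp2 hpl hζ hη hZ hN T).piPM
          (((MulAut.conj i.2 • (M.toTemperedCurve.inertia i.1.1).map M.inclX) ⊓ (M.GtpXu l).map M.inclX).map
            e.toPiCHat.toMonoidHom : Subgroup (ofPiCHat e C μ hC hS hl hp2 hpl hζ hη hZ hN T).Corhat)) ∧
      (∀ g' ∈ (ofPiCHat e C μ hC hS hl hp2 hpl hζ hη hZ hN T).cor, ∀ J : Subgroup (ofPiCHat e C μ hC hS hl hp2 hpl hζ hη hZ hN T).Corhat,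
        Cu.IsCuspidalInertia (ofPiCHat e C μ hC hS hl hp2 hpl hζ hη hZ hN T).piPM J → Cu.IsCuspidalInertia (ofPiCHat e C μ hC hS hl hp2 hpl hζ hη hZ hN T).piPM (MulAut.conj g' • J)) ∧
      ∃ D : Literature.IUT.HodgeTheaters.StableCurveTemperedData.{0},
        Nonempty (StableCurveAgreement (ofPiCHat e C μ hC hS hl hp2 hpl hζ hη hZ hN T) Cu D) :=
  exists_stableCurveAgreement_ofCoverModel e C μ hC hS hl hp2 hpl hζ hη e.toPiCHat e.isProfiniteCompletion_toPiCHat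
    e.toPiCHat_injective e.piCData.aug.toMonoidHom (fun g => e.piCData_aug_apply g) e.piCData.range_aug hZ hN T
    e.piCData.aug.continuous

end PlusMinusTower

end Literature.IUT.HodgeArakelov

end
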